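import Mathlib.Tactic.Ring
import Mathlib.Tactic.LinearCombination
import HarnessLib

/-!
# Venture HSemireg — the u-DEADNESS identities of THEOREM (J) (classification of minimal signed designs; ENGINE-W code A, SERVICE (α), RUNG 3 (i), note P5-ALPHA-MOMENT-A.md v1.13 §2 (J)):
# on a circle `(z − c)(z̄ − c̄) = ρ` one has `c̄·z^{m+1} = z^{m+1} z̄ − (ρ − c c̄)·z^m − c·z^m z̄`, and on a line `c̄ z + c z̄ = b` one has `c̄·z^{m+1} = b·z^m − c·z^m z̄` — so for
# `m + 1 = g` the Weil-corner monomial `z^g` is, ON SUCH A LOCUS, a combination of the NON-CORNER monomials `(g,1), (g−1,0), (g−1,1)`: every signed D2-solution supported on a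
# non-centred circle (`c ≠ 0`) or on a line has `u = M_{g,0} = 0` — ring identities (any commutative ring; `w` stands for `z̄`, `d` for `c̄`)

HONEST FRAMING. Lean index of the computation cell `pub-hsemireg`, widening group ENGINE-W (code A, seat `engine-w-1`, gen 18).
POLYNOMIAL IDENTITIES ONLY. What is NOT formalised: D2's criterion (by value), signed measures, the test-function step (1) of THEOREM (J) (concyclicity), THEOREM (I), or anything
object-level; nothing here says that HC, HC_CM, HC_AV or DIAG(n,d) holds. Theorems only (0 `def`, 0 named fact, 0 `sorry`). New namespace `CircleMonomialReduction`. Companions: #49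
`SingleOrbitMomentRule`, #51 `TwoGSlopeDesignFour`, #52 `TwoGSlopeDesignMechanism` (the other class-side kernel leaves of the (α) note).

SOURCE (the cell's own result, by value): `widen/ENGINE-W/out/p5alpha/P5-ALPHA-MOMENT-A.md` v1.13 §2 (J) «(2) NON-CENTRED CIRCLES ARE u-DEAD: on |z − c|² = ρ with c ≠ 0, z z̄ = ρ − |c|² + c̄z + cz̄,
so c̄·z^g = z^g z̄ − (ρ − |c|²) z^{g−1} − c z^{g−1} z̄ on the circle — a combination of the NON-CORNER monomials (g,1), (g−1,0), (g−1,1); hence u = M_{g,0} = 0 for every solution supported there.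
(3) LINES ARE u-DEAD: on āz + az̄ = b (a ≠ 0): ā·z^g = b z^{g−1} − a z^{g−1} z̄». (With c ≠ 0, dividing by c̄ expresses z^g; the corner (g,0) then contributes nothing independent of the
non-corner conditions, which all vanish for a solution.) What the kernel holds (`z w c d ρ b : R`, `m : ℕ`, read `w = z̄`, `d = c̄`, `g = m + 1`):

* `circle_reduction` — `(z − c)(w − d) = ρ ⟹ d·z^(m+1) = z^(m+1)·w − (ρ − c·d)·z^m − c·(z^m·w)`. [kernel, `linear_combination`]
* `line_reduction` — `d·z + c·w = b ⟹ d·z^(m+1) = b·z^m − c·(z^m·w)`. [kernel, `linear_combination`]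
* `centred_circle_no_reduction_needed` — for `c = 0` the circle relation is `z·w = ρ` and gives instead `z^(m+1)·w = ρ·z^m` (the (g,1) monomial reduces to (g−1,0); `z^g` itself stays
  free — consistent with u ≠ 0 on centred circles, THEOREM (I)). [kernel]
-/

namespace Summit.Ventures.HSemireg.CircleMonomialReduction

/-- **Non-centred circle**: `(z − c)(w − d) = ρ` ⟹ `d·z^(m+1) = z^(m+1)·w − (ρ − c·d)·z^m − c·(z^m·w)`. [kernel] -/
theorem circle_reduction {R : Type*} [CommRing R] (z w c d ρ : R) (m : ℕ) (h : (z - c) * (w - d) = ρ) :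
    d * z ^ (m + 1) = z ^ (m + 1) * w - (ρ - c * d) * z ^ m - c * (z ^ m * w) := by
  linear_combination (-(z ^ m)) * h

/-- **Line**: `d·z + c·w = b` ⟹ `d·z^(m+1) = b·z^m − c·(z^m·w)`. [kernel] -/
theorem line_reduction {R : Type*} [CommRing R] (z w c d b : R) (m : ℕ) (h : d * z + c * w = b) :
    d * z ^ (m + 1) = b * z ^ m - c * (z ^ m * w) := by
  linear_combination (z ^ m) * h

/-- **Centred circle** (`c = 0`): `z·w = ρ` ⟹ `z^(m+1)·w = ρ·z^m` — the relation consumes the (g,1) monomial, not `z^g`. [kernel] -/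
theorem centred_circle_no_reduction_needed {R : Type*} [CommRing R] (z w ρ : R) (m : ℕ) (h : z * w = ρ) :
    z ^ (m + 1) * w = ρ * z ^ m := by
  linear_combination (z ^ m) * h

end Summit.Ventures.HSemireg.CircleMonomialReduction
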